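import Literature.NumberTheory.LFunctions.SelbergMollifierJBound
import Literature.NumberTheory.LFunctions.RHWave0HardyProofs
import Literature.Analysis.FunctionSpaces.PlancherelL1L2
import Literature.Analysis.FluidPDE.NSFourierPlancherel
import HarnessLib

/-!
# Titchmarsh §10.10: `F` and `f` are Fourier transforms; `∫F²` and `∫|∫_t^{t+h}F|²` through `g`

Seventh support file for the proof of A. Selberg's positive-proportion theorem in the arrangement
of E. C. Titchmarsh, *The Theory of the Riemann Zeta-Function*, 2nd ed. (1986), §10.9–§10.22.
Everything here is PROVED; no named facts.

Titchmarsh §10.10 writes `Φ(z) = ∫ Γ(½s)π^{-s/2}ζ(s)φ(s)φ(1-s)z^s ds`, moves the contour and reads off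
that `F(t)` (the kernel `selbergF X δ`) and an explicit `f(y)` are Fourier transforms. We obtain the
same conclusion from the tree's Hardy kernel `Φ(u) = e^{u/4}θ(e^u) - e^{u/4} - e^{-u/4}`
(`Hardy.hardyKernel`, with `Λ(½+it) = 𝓕Φ(t/4π)/2`, `Hardy.completedRiemannZeta_critical_line`):

* §1 `|φ(½+it)|² = ∑_{μ,ν} β_μβ_ν(μν)^{-1/2} e^{it log(μ/ν)}` (`norm_sq_selbergPhi_eq`).
* §2 Translation and line-shift of the Fourier transform: `𝓕(Ψ(·+s))(ξ) = e^{2πisξ}𝓕Ψ(ξ)`,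
  `𝓕(Φ(· - iy₀))(ξ) = e^{2πy₀ξ}𝓕Φ(ξ)` for `0 ≤ y₀ < π/2` (Cauchy on rectangles,
  `Hardy.integral_eq_integral_add_mul_I`).
* §3 With `y₀ = π/2 - δ` and `f̃(v) = ∑_{μ,ν} β_μβ_ν(μν)^{-1/2} Φ(v + 2log(μ/ν) - iy₀)` (`ftil`):
  **`F(t) = 𝓕f̃(t/4π)/2`** (`selbergF_eq_fourier_ftil`).
* §4 Plancherel (`Literature.Analysis.FunctionSpaces.integral_norm_sq_fourierIntegral_eq`):
  `∫F² = π∫|f̃|²` (`integral_selbergF_sq_eq`), and `|f̃|` is even (`norm_ftil_neg`), so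
  `∫|f̃|² = 2∫_0^∞|f̃|²`.
* §5 For real `v`, `x = e^{v/2}`: `f̃(v) = 2x^{1/2}e^{-iy₀/4} g(x) - x^{-1/2}e^{iy₀/4} φ(0)φ(1)` with the
  kernel `g = gfun X δ` of `SelbergMollifierJBound` (`ftil_eq_gfun`; Titchmarsh's
  `f(y) = ½z^{1/2}φ(1)φ(0) - z^{-1/2} g`), hence `|f̃(v)|² ≤ 8x|g(x)|² + 2x⁻¹(φ(0)φ(1))²`
  (`norm_sq_ftil_le`).
* §6 The window `∫_t^{t+h}F = 𝓕(f̃ k_h)(t/4π)/2`, `|k_h(v)| ≤ min(h, 4/|v|)` (§10.7 (10.7.1)), and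
  `∫(∫_t^{t+h}F)² = π∫|f̃ k_h|²`.

## References

* [Titchmarsh1986] E. C. Titchmarsh, *The Theory of the Riemann Zeta-Function*, 2nd ed. revised by
  D. R. Heath-Brown, Oxford 1986, §10.7 (10.7.1), §10.10 (10.10.1).
-/

noncomputable section

open Real Complex MeasureTheory Set Filter Finset
open Literature.NumberTheory.LFunctions.Hardy
open scoped Topology ComplexConjugate FourierTransform Interval

namespace Literature.NumberTheory.LFunctions.SelbergMollifier

/-- The pair coefficients `β_μβ_ν(μν)^{-1/2}`. [cite: Titchmarsh1986, §10.10] -/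
def pairCoeff (X : ℝ) (p : ℕ × ℕ) : ℝ := selbergBeta X p.1 * selbergBeta X p.2 / Real.sqrt ((p.1 : ℝ) * p.2)

/-- `pairCoeff` is symmetric. [folklore] -/
theorem pairCoeff_swap (X : ℝ) (p : ℕ × ℕ) : pairCoeff X p.swap = pairCoeff X p := by
  simp only [pairCoeff, Prod.fst_swap, Prod.snd_swap]; rw [mul_comm (selbergBeta X p.2), mul_comm (p.2 : ℝ)]

/-- `n^w = e^{w log n}` for `n ≥ 1`. [folklore] -/
theorem natCast_cpow_eq_exp {n : ℕ} (hn : 1 ≤ n) (w : ℂ) : (n : ℂ) ^ w = cexp (w * Real.log n) := by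
  have hn0 : (n : ℂ) ≠ 0 := by exact_mod_cast (by omega : n ≠ 0)
  have hpos : (0 : ℝ) < n := by exact_mod_cast (by omega : 0 < n)
  rw [Complex.cpow_def_of_ne_zero hn0, ← Complex.ofReal_natCast, ← Complex.ofReal_log hpos.le, mul_comm]

/-- One term: `μ^{-(½-it)} ν^{-(½+it)} = (μν)^{-1/2} e^{it log(μ/ν)}`. [folklore] -/
theorem cpow_pair_eq {μ ν : ℕ} (hμ : 1 ≤ μ) (hν : 1 ≤ ν) (t : ℝ) :
    (μ : ℂ) ^ (-(1 / 2 - t * I)) * (ν : ℂ) ^ (-(1 / 2 + t * I)) =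
      (((Real.sqrt ((μ : ℝ) * ν))⁻¹ : ℝ) : ℂ) * cexp (I * t * Real.log ((μ : ℝ) / ν)) := by
  have hμ0 : (0 : ℝ) < μ := by exact_mod_cast (by omega : 0 < μ)
  have hν0 : (0 : ℝ) < ν := by exact_mod_cast (by omega : 0 < ν)
  rw [natCast_cpow_eq_exp hμ, natCast_cpow_eq_exp hν, ← Complex.exp_add]
  have hsqrt : ((Real.sqrt ((μ : ℝ) * ν))⁻¹ : ℝ) = Real.exp (-(1 / 2) * (Real.log μ + Real.log ν)) := by
    rw [← Real.log_mul hμ0.ne' hν0.ne', Real.sqrt_eq_rpow, Real.rpow_def_of_pos (by positivity),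
      ← Real.exp_neg]
    ring_nf
  rw [hsqrt, Complex.ofReal_exp, ← Complex.exp_add, Real.log_div hμ0.ne' hν0.ne']
  congr 1
  push_cast
  ring

/-- `conj (n^{-(½+it)}) = n^{-(½-it)}` for `n ≥ 1`. [folklore] -/
theorem conj_natCast_cpow_half {n : ℕ} (hn : 1 ≤ n) (t : ℝ) :
    conj ((n : ℂ) ^ (-(1 / 2 + t * I))) = (n : ℂ) ^ (-(1 / 2 - t * I)) := by
  rw [natCast_cpow_eq_exp hn, natCast_cpow_eq_exp hn, ← Complex.exp_conj]
  congr 1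
  have h2 : conj (2 : ℂ) = 2 := map_ofNat _ 2
  simp only [map_mul, map_neg, map_add, Complex.conj_ofReal, Complex.conj_I, map_div₀, map_one, h2]
  ring

/-- **`|φ(½+it)|² = ∑_{μ,ν<X} β_μβ_ν(μν)^{-1/2} e^{it log(μ/ν)}`** (as complex numbers). [cite: Titchmarsh1986, §10.10] -/
theorem norm_sq_selbergPhi_eq (X t : ℝ) :
    (((‖selbergPhi X (1 / 2 + t * I)‖ ^ 2 : ℝ)) : ℂ) =
      ∑ p ∈ mollRange X ×ˢ mollRange X, ((pairCoeff X p : ℝ) : ℂ) * cexp (I * t * Real.log ((p.1 : ℝ) / p.2)) := by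
  rw [← Complex.normSq_eq_norm_sq, ← Complex.mul_conj, mul_comm]
  rw [selbergPhi, map_sum, Finset.sum_mul_sum, Finset.sum_product]
  refine Finset.sum_congr rfl fun μ hμ ↦ Finset.sum_congr rfl fun ν hν ↦ ?_
  have hμ1 := one_le_of_mem_mollRange hμ
  have hν1 := one_le_of_mem_mollRange hν
  rw [map_mul, Complex.conj_ofReal, conj_natCast_cpow_half hμ1]
  rw [show ((selbergBeta X μ : ℝ) : ℂ) * (μ : ℂ) ^ (-(1 / 2 - (t : ℂ) * I)) *
      (((selbergBeta X ν : ℝ) : ℂ) * (ν : ℂ) ^ (-(1 / 2 + (t : ℂ) * I))) =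
      ((selbergBeta X μ : ℝ) : ℂ) * ((selbergBeta X ν : ℝ) : ℂ) *
        ((μ : ℂ) ^ (-(1 / 2 - (t : ℂ) * I)) * (ν : ℂ) ^ (-(1 / 2 + (t : ℂ) * I))) by ring,
    cpow_pair_eq hμ1 hν1, pairCoeff, div_eq_mul_inv]
  push_cast
  ring

/-! ## §2 Translation and line shift of the Fourier transform -/

/-- **Translation**: `𝓕(Ψ(· + s))(ξ) = e^{2πisξ} 𝓕Ψ(ξ)`. [folklore] -/
theorem fourier_comp_add_right (Ψ : ℝ → ℂ) (s ξ : ℝ) :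
    𝓕 (fun v : ℝ ↦ Ψ (v + s)) ξ = cexp (2 * π * I * s * ξ) * 𝓕 Ψ ξ := by
  rw [Real.fourier_real_eq_integral_exp_smul, Real.fourier_real_eq_integral_exp_smul, ← integral_const_mul,
    ← integral_sub_right_eq_self (fun v : ℝ ↦ cexp (↑(-2 * π * v * ξ) * I) • Ψ (v + s)) s]
  refine integral_congr_ae (Eventually.of_forall fun w ↦ ?_)
  simp only [smul_eq_mul, sub_add_cancel]
  have : cexp (↑(-2 * π * (w - s) * ξ) * I) = cexp (2 * π * I * s * ξ) * cexp (↑(-2 * π * w * ξ) * I) := by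
    rw [← Complex.exp_add]; congr 1; push_cast; ring
  rw [this, mul_assoc]

/-- **Line shift for the Hardy kernel**: `𝓕(Φ(· - iy₀))(ξ) = e^{2πy₀ξ} 𝓕Φ(ξ)` for `0 ≤ y₀ < π/2`
(Cauchy's theorem on the strip `-y₀ ≤ im ≤ 0`, with the uniform decay of `Φ`). [folklore] -/
theorem fourier_hardyKernel_shift {y₀ : ℝ} (hy0 : 0 ≤ y₀) (hy : y₀ < π / 2) (ξ : ℝ) :
    𝓕 (fun v : ℝ ↦ hardyKernel (v - y₀ * I)) ξ = cexp (2 * π * y₀ * ξ) * 𝓕 hardyKernelReal ξ := by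
  set H : ℂ → ℂ := fun w ↦ cexp (-(2 * π * I * w * ξ)) * hardyKernel w with hH
  have hyabs : |(-y₀)| < π / 2 := by rw [abs_neg, abs_of_nonneg hy0]; exact hy
  obtain ⟨M, hM, hMb⟩ := norm_hardyKernel_le hy0 hy
  set K₀ : ℝ := Real.exp (2 * π * y₀ * |ξ|) with hK₀
  -- the exponential factor is bounded by `K₀` on the strip
  have hexp_bound : ∀ w : ℂ, |w.im| ≤ y₀ → ‖cexp (-(2 * π * I * w * ξ))‖ ≤ K₀ := by
    intro w hw
    rw [Complex.norm_exp]
    refine Real.exp_le_exp.mpr ?_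
    have : (-(2 * π * I * w * ξ)).re = 2 * π * w.im * ξ := by
      simp [Complex.mul_re, Complex.mul_im]
    rw [this]
    have h1 : w.im * ξ ≤ y₀ * |ξ| := by
      calc w.im * ξ ≤ |w.im * ξ| := le_abs_self _
        _ = |w.im| * |ξ| := abs_mul _ _
        _ ≤ y₀ * |ξ| := mul_le_mul_of_nonneg_right hw (abs_nonneg _)
    nlinarith [Real.pi_pos]
  -- `H` on the real line and on `im = -y₀`
  have e1 : (fun x : ℝ ↦ cexp (↑(-2 * π * x * ξ) * I) • hardyKernelReal x) = fun x : ℝ ↦ H x := by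
    funext x; simp only [hH, hardyKernelReal, smul_eq_mul]; congr 1; congr 1; push_cast; ring
  have e2 : (fun x : ℝ ↦ H (x + ((-y₀ : ℝ) : ℂ) * I)) =
      fun x : ℝ ↦ cexp (-(2 * π * y₀ * ξ)) * (cexp (↑(-2 * π * x * ξ) * I) • hardyKernel (x - y₀ * I)) := by
    funext x
    simp only [hH, smul_eq_mul]
    have harg : (x : ℂ) + ((-y₀ : ℝ) : ℂ) * I = x - y₀ * I := by push_cast; ring
    have key : -(2 * π * I * ((x : ℂ) - y₀ * I) * ξ) = -(2 * π * y₀ * ξ : ℂ) + (((-2 * π * x * ξ : ℝ)) : ℂ) * I := by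
      have hI : I * I = -1 := Complex.I_mul_I
      push_cast
      linear_combination (2 * π * y₀ * ξ : ℂ) * hI
    rw [harg, key, Complex.exp_add, mul_assoc]
  -- differentiability on the strip
  have hd : DifferentiableOn ℂ H (univ ×ℂ [[0, -y₀]]) := by
    intro w hw
    have hwim : |w.im| < π / 2 := by
      have := abs_sub_left_of_mem_uIcc hw.2
      simp only [sub_zero] at this
      exact lt_of_le_of_lt (by rw [abs_neg, abs_of_nonneg hy0] at this; exact this) hy
    exact ((by fun_prop : DifferentiableAt ℂ (fun w ↦ cexp (-(2 * π * I * w * ξ))) w).mul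
      (differentiableAt_hardyKernel hwim)).differentiableWithinAt
  -- integrability on `ℝ`
  have h0 : Integrable (fun x : ℝ ↦ H x) := by
    rw [← e1]
    refine integrable_hardyKernelReal.bdd_mul (c := K₀) (by fun_prop) ?_
    filter_upwards with x
    rw [Complex.norm_exp]
    have hre : (((-2 * π * x * ξ : ℝ) : ℂ) * I).re = 0 := by simp
    rw [hre, Real.exp_zero, hK₀]
    exact Real.one_le_exp (by positivity)
  -- integrability on `im = -y₀`
  have h1 : Integrable (fun x : ℝ ↦ H (x + ((-y₀ : ℝ) : ℂ) * I)) := by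
    rw [e2]
    refine Integrable.const_mul ?_ _
    have hint := integrable_hardyKernel_horizontal hyabs
    have : (fun x : ℝ ↦ hardyKernel (x - y₀ * I)) = fun x : ℝ ↦ hardyKernel (x + (-y₀ : ℝ) * I) := by
      funext x; congr 1; push_cast; ring
    rw [show (fun x : ℝ ↦ cexp (↑(-2 * π * x * ξ) * I) • hardyKernel (↑x - ↑y₀ * I)) =
      fun x : ℝ ↦ cexp (↑(-2 * π * x * ξ) * I) * hardyKernel (x + (-y₀ : ℝ) * I) by
      funext x; rw [smul_eq_mul]; congr 1; push_cast; ring]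
    refine hint.bdd_mul (c := 1) (by fun_prop) ?_
    filter_upwards with x
    rw [Complex.norm_exp]
    simp
  -- decay at the vertical edges
  have hdecay : ∀ ε > 0, ∃ R₀, ∀ R s : ℝ, R₀ ≤ |R| → s ∈ [[0, -y₀]] → ‖H (R + s * I)‖ ≤ ε := by
    intro ε hε
    obtain ⟨R₁, hR₁⟩ := (Real.tendsto_exp_neg_atTop_nhds_zero.eventually
      (gt_mem_nhds (show (0 : ℝ) < ε / (M * K₀ + 1) by positivity))).exists_forall_of_atTop
    refine ⟨4 * max R₁ 0, fun R s hR hs ↦ ?_⟩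
    have hsy : |s| ≤ y₀ := by
      have := abs_sub_left_of_mem_uIcc hs
      simp only [sub_zero] at this
      rwa [abs_neg, abs_of_nonneg hy0] at this
    have hk : ‖hardyKernel (R + s * I)‖ ≤ M * Real.exp (-(|R| / 4)) := by
      simpa using hMb (R + s * I) (by simpa using hsy)
    have hE := hexp_bound ((R : ℂ) + s * I) (by simpa using hsy)
    have h3 : Real.exp (-(|R| / 4)) < ε / (M * K₀ + 1) := by
      have : Real.exp (-(|R| / 4)) ≤ Real.exp (-(max R₁ 0)) := Real.exp_le_exp.mpr (by linarith)
      refine lt_of_le_of_lt (this.trans ?_) (hR₁ (max R₁ 0) (le_max_left _ _))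
      simp
    calc ‖H (R + s * I)‖ = ‖cexp (-(2 * π * I * ((R : ℂ) + s * I) * ξ))‖ * ‖hardyKernel (R + s * I)‖ := norm_mul _ _
      _ ≤ K₀ * (M * Real.exp (-(|R| / 4))) := by gcongr
      _ = (M * K₀) * Real.exp (-(|R| / 4)) := by ring
      _ ≤ (M * K₀ + 1) * Real.exp (-(|R| / 4)) := by gcongr; linarith
      _ ≤ (M * K₀ + 1) * (ε / (M * K₀ + 1)) := by gcongr
      _ = ε := mul_div_cancel₀ ε (by positivity)
  have hshift := integral_eq_integral_add_mul_I H (-y₀) hd h0 h1 hdecay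
  rw [Real.fourier_real_eq_integral_exp_smul hardyKernelReal, e1, hshift, e2, integral_const_mul,
    Real.fourier_real_eq_integral_exp_smul, ← mul_assoc, ← Complex.exp_add]
  have : (2 * π * y₀ * ξ : ℂ) + -(2 * π * y₀ * ξ) = 0 := by ring
  rw [this, Complex.exp_zero, one_mul]

/-! ## §3 `F = 𝓕f̃(·/4π)/2` -/

/-- `y₀ = π/2 - δ`. [cite: Titchmarsh1986, §10.10] -/
def yZero (δ : ℝ) : ℝ := π / 2 - δ

/-- `0 ≤ y₀ < π/2` for `0 < δ ≤ 1`. [folklore] -/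
theorem yZero_bounds {δ : ℝ} (hδ : 0 < δ) (hδ1 : δ ≤ 1) : 0 ≤ yZero δ ∧ yZero δ < π / 2 := by
  unfold yZero; constructor <;> nlinarith [Real.pi_gt_three]

/-- The shifted Hardy kernel `v ↦ Φ(v + s - iy₀)`. [cite: Titchmarsh1986, §10.10] -/
def hardyShift (δ s : ℝ) (v : ℝ) : ℂ := hardyKernel (v + s - yZero δ * I)

/-- **Titchmarsh's `f`** (up to normalisation): `f̃(v) = ∑_{μ,ν<X} β_μβ_ν(μν)^{-1/2} Φ(v + 2log(μ/ν) - iy₀)`.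
[cite: Titchmarsh1986, §10.10] -/
def ftil (X δ : ℝ) (v : ℝ) : ℂ :=
  ∑ p ∈ mollRange X ×ˢ mollRange X, ((pairCoeff X p : ℝ) : ℂ) * hardyShift δ (2 * Real.log ((p.1 : ℝ) / p.2)) v

section FourierSide

variable {X δ : ℝ}

/-- The shifted kernel is a translate of the kernel on the line `im = -y₀`. [folklore] -/
theorem hardyShift_eq (δ s : ℝ) : hardyShift δ s = fun v : ℝ ↦ (fun w : ℝ ↦ hardyKernel (w + (-yZero δ : ℝ) * I)) (v + s) := by
  funext v; simp only [hardyShift]; congr 1; push_cast; ring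

/-- The shifted kernel is integrable. [folklore] -/
theorem integrable_hardyShift (hδ : 0 < δ) (hδ1 : δ ≤ 1) (s : ℝ) : Integrable (hardyShift δ s) := by
  obtain ⟨hy0, hy⟩ := yZero_bounds hδ hδ1
  have hyabs : |(-yZero δ)| < π / 2 := by rw [abs_neg, abs_of_nonneg hy0]; exact hy
  rw [hardyShift_eq]
  exact (integrable_hardyKernel_horizontal hyabs).comp_add_right s

/-- The shifted kernel is continuous. [folklore] -/
theorem continuous_hardyShift (hδ : 0 < δ) (hδ1 : δ ≤ 1) (s : ℝ) : Continuous (hardyShift δ s) := by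
  obtain ⟨hy0, hy⟩ := yZero_bounds hδ hδ1
  have hyabs : |(-yZero δ)| < π / 2 := by rw [abs_neg, abs_of_nonneg hy0]; exact hy
  rw [hardyShift_eq]
  exact (continuous_hardyKernel_horizontal hyabs).comp (continuous_id.add continuous_const)

/-- The shifted kernel is uniformly bounded. [folklore] -/
theorem exists_bound_hardyShift (hδ : 0 < δ) (hδ1 : δ ≤ 1) :
    ∃ M : ℝ, 0 < M ∧ ∀ s v : ℝ, ‖hardyShift δ s v‖ ≤ M := by
  obtain ⟨hy0, hy⟩ := yZero_bounds hδ hδ1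
  obtain ⟨M, hM, hMb⟩ := norm_hardyKernel_le hy0 hy
  refine ⟨M, hM, fun s v ↦ ?_⟩
  rw [hardyShift]
  refine (hMb _ (by simp [abs_of_nonneg hy0])).trans ?_
  have : Real.exp (-(|((v : ℂ) + s - yZero δ * I).re| / 4)) ≤ 1 :=
    Real.exp_le_one_iff.mpr (by have := abs_nonneg ((v : ℂ) + s - yZero δ * I).re; linarith)
  nlinarith

/-- **Fourier transform of the shifted kernel**: `𝓕(Φ(·+s-iy₀))(ξ) = e^{2πisξ} e^{2πy₀ξ} 𝓕Φ(ξ)`.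
[cite: Titchmarsh1986, §10.10] -/
theorem fourier_hardyShift (hδ : 0 < δ) (hδ1 : δ ≤ 1) (s ξ : ℝ) :
    𝓕 (hardyShift δ s) ξ = cexp (2 * π * I * s * ξ) * cexp (2 * π * yZero δ * ξ) * 𝓕 hardyKernelReal ξ := by
  obtain ⟨hy0, hy⟩ := yZero_bounds hδ hδ1
  set Ψ : ℝ → ℂ := fun w ↦ hardyKernel (w - yZero δ * I) with hΨ
  have h1 : hardyShift δ s = fun v : ℝ ↦ Ψ (v + s) := by
    funext v; simp only [hardyShift, hΨ]; congr 1; push_cast; ring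
  rw [h1, fourier_comp_add_right Ψ s ξ, hΨ, fourier_hardyKernel_shift hy0 hy, mul_assoc]
  ring_nf

/-- `f̃` is integrable. [folklore] -/
theorem integrable_ftil (hδ : 0 < δ) (hδ1 : δ ≤ 1) (X : ℝ) : Integrable (ftil X δ) := by
  unfold ftil
  exact integrable_finsetSum _ fun p _ ↦ (integrable_hardyShift hδ hδ1 _).const_mul _

/-- `f̃` is continuous. [folklore] -/
theorem continuous_ftil (hδ : 0 < δ) (hδ1 : δ ≤ 1) (X : ℝ) : Continuous (ftil X δ) := by
  unfold ftil
  exact continuous_finsetSum _ fun p _ ↦ (continuous_hardyShift hδ hδ1 _).const_mul _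

/-- `f̃` is bounded. [folklore] -/
theorem exists_bound_ftil (hδ : 0 < δ) (hδ1 : δ ≤ 1) (X : ℝ) : ∃ B : ℝ, ∀ v : ℝ, ‖ftil X δ v‖ ≤ B := by
  obtain ⟨M, hM, hMb⟩ := exists_bound_hardyShift hδ hδ1
  refine ⟨∑ p ∈ mollRange X ×ˢ mollRange X, |pairCoeff X p| * M, fun v ↦ ?_⟩
  unfold ftil
  refine (norm_sum_le _ _).trans (Finset.sum_le_sum fun p _ ↦ ?_)
  rw [norm_mul, Complex.norm_real, Real.norm_eq_abs]
  exact mul_le_mul_of_nonneg_left (hMb _ _) (abs_nonneg _)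

/-- `f̃ ∈ L²`. [folklore] -/
theorem memLp_ftil (hδ : 0 < δ) (hδ1 : δ ≤ 1) (X : ℝ) : MemLp (ftil X δ) 2 := by
  obtain ⟨B, hB⟩ := exists_bound_ftil hδ hδ1 X
  exact Literature.Analysis.FluidPDE.FourierNS.memLp_two_of_bound (integrable_ftil hδ hδ1 X) hB

/-- **Linearity**: `𝓕f̃ = ∑ c_p 𝓕(shifted kernels)`. [folklore] -/
theorem fourier_ftil (hδ : 0 < δ) (hδ1 : δ ≤ 1) (X ξ : ℝ) :
    𝓕 (ftil X δ) ξ = ∑ p ∈ mollRange X ×ˢ mollRange X,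
      ((pairCoeff X p : ℝ) : ℂ) * 𝓕 (hardyShift δ (2 * Real.log ((p.1 : ℝ) / p.2))) ξ := by
  rw [Real.fourier_real_eq_integral_exp_smul]
  have hint : ∀ p ∈ mollRange X ×ˢ mollRange X, Integrable (fun v : ℝ ↦
      cexp (↑(-2 * π * v * ξ) * I) • (((pairCoeff X p : ℝ) : ℂ) * hardyShift δ (2 * Real.log ((p.1 : ℝ) / p.2)) v)) := by
    intro p _
    refine ((integrable_hardyShift hδ hδ1 _).const_mul _).bdd_mul (c := 1) (by fun_prop) ?_
    filter_upwards with v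
    rw [Complex.norm_exp]; simp
  simp only [ftil, Finset.smul_sum]
  rw [integral_finsetSum _ hint]
  refine Finset.sum_congr rfl fun p _ ↦ ?_
  rw [Real.fourier_real_eq_integral_exp_smul, ← integral_const_mul]
  refine integral_congr_ae (Eventually.of_forall fun v ↦ ?_)
  simp only [smul_eq_mul]; ring

/-- **`F(t) = 𝓕f̃(t/4π)/2`** (Titchmarsh §10.10: "`F(t)` … and `f(y)` … are Fourier transforms").
[cite: Titchmarsh1986, §10.10] -/
theorem selbergF_eq_fourier_ftil (hδ : 0 < δ) (hδ1 : δ ≤ 1) (X t : ℝ) :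
    ((selbergF X δ t : ℝ) : ℂ) = 𝓕 (ftil X δ) (t / (4 * π)) / 2 := by
  rw [fourier_ftil hδ hδ1]
  have hΛ := completedRiemannZeta_critical_line t
  have hΛreal : ((completedRiemannZeta (1 / 2 + t * I)).re : ℂ) = completedRiemannZeta (1 / 2 + t * I) :=
    Complex.conj_eq_iff_re.mp (Complex.conj_eq_iff_im.mpr (completedRiemannZeta_im_eq_zero_of_re_eq_half t))
  -- each summand: `c_p e^{it log(μ/ν)} e^{(π/4-δ/2)t} 𝓕Φ(t/4π)`
  have hterm : ∀ p ∈ mollRange X ×ˢ mollRange X,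
      ((pairCoeff X p : ℝ) : ℂ) * 𝓕 (hardyShift δ (2 * Real.log ((p.1 : ℝ) / p.2))) (t / (4 * π)) =
        (((pairCoeff X p : ℝ) : ℂ) * cexp (I * t * Real.log ((p.1 : ℝ) / p.2))) *
          (cexp ((((π / 4 - δ / 2) * t : ℝ)) : ℂ) * (2 * completedRiemannZeta (1 / 2 + t * I))) := by
    intro p _
    rw [fourier_hardyShift hδ hδ1, hΛ]
    have hπ : (π : ℂ) ≠ 0 := Complex.ofReal_ne_zero.mpr Real.pi_pos.ne'
    have e1 : cexp (2 * π * I * (2 * Real.log ((p.1 : ℝ) / p.2) : ℝ) * (t / (4 * π) : ℝ)) =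
        cexp (I * t * Real.log ((p.1 : ℝ) / p.2)) := by
      congr 1; push_cast; field_simp; ring
    have e2 : cexp (2 * π * (yZero δ : ℂ) * (t / (4 * π) : ℝ)) = cexp ((((π / 4 - δ / 2) * t : ℝ)) : ℂ) := by
      congr 1; unfold yZero; push_cast; field_simp; ring
    rw [e1, e2]
    field_simp
  rw [Finset.sum_congr rfl hterm, ← Finset.sum_mul, ← norm_sq_selbergPhi_eq, selbergF, ← hΛreal]
  set L : ℝ := (completedRiemannZeta (1 / 2 + t * I)).re
  push_cast
  simp only [Complex.ofReal_re]
  ring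

/-! ## §4 Plancherel: `∫F² = π∫|f̃|²`, and `|f̃|` is even -/

/-- **Plancherel in the normalisation `W(t) = 𝓕f(t/4π)/2`**: `∫W² = π∫|f|²` for `f ∈ L¹ ∩ L²`, with
integrability of `W²`. [folklore] -/
theorem integral_sq_eq_pi_mul {f : ℝ → ℂ} (hf : Integrable f) (h2 : MemLp f 2 volume) {W : ℝ → ℝ}
    (hW : ∀ t : ℝ, ((W t : ℝ) : ℂ) = 𝓕 f (t / (4 * π)) / 2) :
    Integrable (fun t : ℝ ↦ W t ^ 2) ∧ ∫ t : ℝ, W t ^ 2 = π * ∫ v : ℝ, ‖f v‖ ^ 2 := by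
  have hF2 := Literature.Analysis.FunctionSpaces.memLp_two_fourierIntegral hf h2
  have hint : Integrable (fun ξ : ℝ ↦ ‖𝓕 f ξ‖ ^ 2) := (memLp_two_iff_integrable_sq_norm hF2.1).mp hF2
  have hP := Literature.Analysis.FunctionSpaces.integral_norm_sq_fourierIntegral_eq hf h2
  set gsq : ℝ → ℝ := fun ξ ↦ ‖𝓕 f ξ‖ ^ 2 / 4 with hgsq
  have hpt : ∀ t : ℝ, W t ^ 2 = gsq (t / (4 * π)) := by
    intro t
    have : W t ^ 2 = ‖((W t : ℝ) : ℂ)‖ ^ 2 := by rw [Complex.norm_real, Real.norm_eq_abs, sq_abs]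
    rw [this, hW t, hgsq]
    simp only [norm_div, Complex.norm_ofNat]
    ring
  have hfun : (fun t : ℝ ↦ W t ^ 2) = fun t : ℝ ↦ gsq (t / (4 * π)) := funext hpt
  have hgint : Integrable gsq := hint.div_const 4
  constructor
  · rw [hfun]; exact hgint.comp_div (by positivity)
  · rw [hfun, Measure.integral_comp_div gsq (4 * π), abs_of_pos (by positivity), smul_eq_mul, hgsq]
    simp only []
    rw [integral_div, hP]
    ring

/-- **`∫F² = π ∫|f̃|²`**, with integrability of `F²`. [cite: Titchmarsh1986, §10.10] -/
theorem integral_selbergF_sq_eq (hδ : 0 < δ) (hδ1 : δ ≤ 1) (X : ℝ) :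
    Integrable (fun t : ℝ ↦ selbergF X δ t ^ 2) ∧
      ∫ t : ℝ, selbergF X δ t ^ 2 = π * ∫ v : ℝ, ‖ftil X δ v‖ ^ 2 :=
  integral_sq_eq_pi_mul (integrable_ftil hδ hδ1 X) (memLp_ftil hδ hδ1 X) (selbergF_eq_fourier_ftil hδ hδ1 X)

/-- **`|f̃|` is even** (`Φ` is even and commutes with conjugation; `μ ↔ ν`). [folklore] -/
theorem norm_ftil_neg (hδ : 0 < δ) (hδ1 : δ ≤ 1) (X v : ℝ) : ‖ftil X δ (-v)‖ = ‖ftil X δ v‖ := by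
  obtain ⟨hy0, hy⟩ := yZero_bounds hδ hδ1
  have hconj : ftil X δ (-v) = conj (ftil X δ v) := by
    rw [ftil, ftil, map_sum]
    -- reindex the right-hand side by `p ↦ p.swap`
    rw [← Finset.sum_equiv (Equiv.prodComm ℕ ℕ) (s := mollRange X ×ˢ mollRange X) (t := mollRange X ×ˢ mollRange X)
      (g := fun p ↦ conj (((pairCoeff X p : ℝ) : ℂ) * hardyShift δ (2 * Real.log ((p.1 : ℝ) / p.2)) v))
      (fun p ↦ by simp [Finset.mem_product, and_comm]) (fun p _ ↦ rfl)]
    refine Finset.sum_congr rfl fun p hp ↦ ?_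
    obtain ⟨h1, h2⟩ := pos_of_mem_prod hp
    simp only [Equiv.prodComm_apply, Prod.fst_swap, Prod.snd_swap, map_mul, Complex.conj_ofReal]
    rw [pairCoeff_swap X p]
    congr 1
    rw [hardyShift, hardyShift, hardyKernel_conj]
    have hlog : Real.log ((p.2 : ℝ) / p.1) = -Real.log ((p.1 : ℝ) / p.2) := by
      rw [← Real.log_inv, inv_div]
    rw [hlog, ← hardyKernel_neg (u := (((-v : ℝ)) : ℂ) + ((2 * Real.log ((p.1 : ℝ) / p.2) : ℝ) : ℂ) - yZero δ * I)]
    · congr 1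
      simp only [map_sub, map_add, Complex.conj_ofReal, map_mul, Complex.conj_I]
      push_cast; ring
    · simp only [Complex.sub_im, Complex.add_im, Complex.ofReal_im, Complex.mul_im, Complex.ofReal_re,
        Complex.I_im, Complex.I_re]
      have : yZero δ < π := by linarith [Real.pi_pos]
      rw [show (0 : ℝ) + 0 - (yZero δ * 1 + 0 * 0) = -yZero δ by ring, abs_neg, abs_of_nonneg hy0]
      exact this
  rw [hconj, Complex.norm_conj]

/-- **`∫|f̃|² = 2∫_0^∞|f̃|²`.** [cite: Titchmarsh1986, §10.18] -/
theorem integral_norm_sq_ftil_eq (hδ : 0 < δ) (hδ1 : δ ≤ 1) (X : ℝ) :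
    ∫ v : ℝ, ‖ftil X δ v‖ ^ 2 = 2 * ∫ v in Ioi (0 : ℝ), ‖ftil X δ v‖ ^ 2 := by
  rw [← integral_comp_abs (f := fun v ↦ ‖ftil X δ v‖ ^ 2)]
  refine integral_congr_ae (Eventually.of_forall fun v ↦ ?_)
  simp only
  rcases le_or_gt 0 v with h | h
  · rw [abs_of_nonneg h]
  · rw [abs_of_neg h, norm_ftil_neg hδ hδ1]

/-! ## §5 `f̃` for `v > 0` in terms of `g` -/

/-- `P₀ = φ(1)φ(0) = (∑ β_μ/μ)(∑ β_ν)`. [cite: Titchmarsh1986, §10.10] -/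
def phiProd (X : ℝ) : ℝ := (∑ μ ∈ mollRange X, selbergBeta X μ / μ) * ∑ ν ∈ mollRange X, selbergBeta X ν

/-- `θ(w) - 1 = 2∑_{n≥1} e^{-πn²w}` for `re w > 0`. [folklore] -/
theorem thetaI_sub_one_eq {w : ℂ} (hw : 0 < w.re) : thetaI w - 1 = 2 * ∑' n : ℕ, cexp (-(π * ((n : ℂ) + 1) ^ 2 * w)) := by
  have him : 0 < (I * w).im := by simpa using hw
  rw [thetaI, ← jacobiTheta_eq_jacobiTheta₂, jacobiTheta_eq_tsum_nat him, add_sub_cancel_left]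
  congr 1
  refine tsum_congr fun n ↦ ?_
  congr 1
  rw [show (π : ℂ) * I * ((n : ℂ) + 1) ^ 2 * (I * w) = π * ((n : ℂ) + 1) ^ 2 * w * (I * I) by ring, Complex.I_mul_I]
  ring

section Pos

/-- `e^{-iy₀} = sin δ - i cos δ`. [folklore] -/
theorem cexp_neg_I_yZero (δ : ℝ) : cexp (-(I * yZero δ)) = (Real.sin δ : ℂ) - I * Real.cos δ := by
  rw [show -(I * (yZero δ : ℂ)) = ((-yZero δ : ℝ) : ℂ) * I by rw [Complex.ofReal_neg]; ring, Complex.exp_mul_I]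
  rw [← Complex.ofReal_cos, ← Complex.ofReal_sin, Real.cos_neg, Real.sin_neg, yZero, Real.cos_pi_div_two_sub,
    Real.sin_pi_div_two_sub, Complex.ofReal_neg]
  ring

/-- The argument `u = v + 2log(μ/ν) - iy₀` and `e^u = x²(μ/ν)²(sin δ - i cos δ)`, `x = e^{v/2}`. [folklore] -/
theorem cexp_arg_eq {μ ν : ℝ} (hμ : 0 < μ) (hν : 0 < ν) (v δ : ℝ) :
    cexp ((v : ℂ) + ((2 * Real.log (μ / ν) : ℝ) : ℂ) - yZero δ * I) =
      (((Real.exp (v / 2)) ^ 2 * (μ / ν) ^ 2 : ℝ) : ℂ) * ((Real.sin δ : ℂ) - I * Real.cos δ) := by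
  rw [show (v : ℂ) + ((2 * Real.log (μ / ν) : ℝ) : ℂ) - yZero δ * I =
      (((v + 2 * Real.log (μ / ν) : ℝ)) : ℂ) + -(I * yZero δ) by push_cast; ring,
    Complex.exp_add, cexp_neg_I_yZero, ← Complex.ofReal_exp, Real.exp_add]
  congr 2
  congr 1
  · rw [← Real.exp_nat_mul]; ring_nf
  · rw [show (2 : ℝ) * Real.log (μ / ν) = Real.log (μ / ν) * 2 by ring, Real.exp_mul, Real.exp_log (by positivity)]
    norm_cast

/-- `re e^u > 0`. [folklore] -/
theorem re_cexp_arg_pos (hδ : 0 < δ) (hδ1 : δ ≤ 1) (v s : ℝ) : 0 < (cexp ((v : ℂ) + (s : ℂ) - yZero δ * I)).re := by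
  obtain ⟨hy0, hy⟩ := yZero_bounds hδ hδ1
  refine re_cexp_pos ?_
  simp [abs_of_nonneg hy0, hy]

/-- The coefficient identities `c_p (μ/ν)^{1/2} = β_μβ_ν/ν`, `c_p (ν/μ)^{1/2} = β_μβ_ν/μ`. [folklore] -/
theorem pairCoeff_mul_sqrt {p : ℕ × ℕ} (hp : p ∈ mollRange X ×ˢ mollRange X) :
    pairCoeff X p * Real.sqrt ((p.1 : ℝ) / p.2) = gCoeff X p ∧
      pairCoeff X p * Real.sqrt ((p.2 : ℝ) / p.1) = selbergBeta X p.1 * selbergBeta X p.2 / p.1 := by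
  obtain ⟨h1, h2⟩ := pos_of_mem_prod hp
  have hs1 : Real.sqrt (p.1 : ℝ) ≠ 0 := (Real.sqrt_pos.mpr h1).ne'
  have hs2 : Real.sqrt (p.2 : ℝ) ≠ 0 := (Real.sqrt_pos.mpr h2).ne'
  have e1 : Real.sqrt ((p.1 : ℝ) * p.2) = Real.sqrt p.1 * Real.sqrt p.2 := Real.sqrt_mul h1.le _
  have e2 : Real.sqrt ((p.1 : ℝ) / p.2) = Real.sqrt p.1 / Real.sqrt p.2 := Real.sqrt_div h1.le _
  have e3 : Real.sqrt ((p.2 : ℝ) / p.1) = Real.sqrt p.2 / Real.sqrt p.1 := Real.sqrt_div h2.le _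
  have q1 : (p.1 : ℝ) = Real.sqrt p.1 * Real.sqrt p.1 := (Real.mul_self_sqrt h1.le).symm
  have q2 : (p.2 : ℝ) = Real.sqrt p.2 * Real.sqrt p.2 := (Real.mul_self_sqrt h2.le).symm
  constructor
  · rw [pairCoeff, gCoeff, e1, e2]
    conv_rhs => rw [q2]
    field_simp
  · rw [pairCoeff, e1, e3]
    conv_rhs => rw [q1]
    field_simp

/-- **One term of `f̃` for real `v`**:
`c_p Φ(u_p) = 2e^{v/4}e^{-iy₀/4} ∑_n a_{p,n}(e^{v/2}) - e^{-v/4}e^{iy₀/4} β_μβ_ν/μ`. [cite: Titchmarsh1986, §10.10] -/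
theorem pairCoeff_mul_hardyShift (hδ : 0 < δ) (hδ1 : δ ≤ 1) {p : ℕ × ℕ} (hp : p ∈ mollRange X ×ˢ mollRange X) (v : ℝ) :
    ((pairCoeff X p : ℝ) : ℂ) * hardyShift δ (2 * Real.log ((p.1 : ℝ) / p.2)) v =
      2 * cexp ((v / 4 : ℝ) : ℂ) * cexp (-(I * yZero δ / 4)) * ∑' n : ℕ, gTerm X δ p n (Real.exp (v / 2)) -
        cexp ((-(v / 4) : ℝ) : ℂ) * cexp (I * yZero δ / 4) * ((selbergBeta X p.1 * selbergBeta X p.2 / p.1 : ℝ) : ℂ) := by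
  obtain ⟨h1, h2⟩ := pos_of_mem_prod hp
  obtain ⟨hc1, hc2⟩ := pairCoeff_mul_sqrt (X := X) hp
  set r : ℝ := (p.1 : ℝ) / p.2 with hr
  have hr0 : 0 < r := by positivity
  set u : ℂ := (v : ℂ) + ((2 * Real.log r : ℝ) : ℂ) - yZero δ * I with hu
  have hshift : hardyShift δ (2 * Real.log r) v = hardyKernel u := rfl
  rw [hshift, hardyKernel_eq u, thetaI_sub_one_eq (by rw [hu]; exact re_cexp_arg_pos hδ hδ1 v _)]
  -- `e^{u/4}` and `e^{-u/4}`
  have hlog4 : Real.exp (2 * Real.log r / 4) = Real.sqrt r := by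
    rw [show 2 * Real.log r / 4 = Real.log r / 2 by ring, Real.sqrt_eq_rpow, Real.rpow_def_of_pos hr0]; ring_nf
  have hlog4' : Real.exp (-(2 * Real.log r / 4)) = Real.sqrt (r⁻¹) := by
    rw [show -(2 * Real.log r / 4) = Real.log r⁻¹ / 2 by rw [Real.log_inv]; ring, Real.sqrt_eq_rpow,
      Real.rpow_def_of_pos (inv_pos.mpr hr0)]; ring_nf
  have hu4 : cexp (u / 4) = cexp ((v / 4 : ℝ) : ℂ) * (Real.sqrt r : ℂ) * cexp (-(I * yZero δ / 4)) := by
    rw [hu, ← hlog4, Complex.ofReal_exp, ← Complex.exp_add, ← Complex.exp_add]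
    congr 1; push_cast; ring
  have hu4' : cexp (-(u / 4)) = cexp ((-(v / 4) : ℝ) : ℂ) * (Real.sqrt (r⁻¹) : ℂ) * cexp (I * yZero δ / 4) := by
    rw [hu, ← hlog4', Complex.ofReal_exp, ← Complex.exp_add, ← Complex.exp_add]
    congr 1; push_cast; ring
  -- the Gaussian terms
  have hcexp : cexp u = (((Real.exp (v / 2)) ^ 2 * r ^ 2 : ℝ) : ℂ) * ((Real.sin δ : ℂ) - I * Real.cos δ) := by
    rw [hu, hr]; exact cexp_arg_eq h1 h2 v δ
  have hgauss : ∀ n : ℕ, cexp (-(π * ((n : ℂ) + 1) ^ 2 * cexp u)) =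
      cexp (gPhase δ (gFreq p n) * (((Real.exp (v / 2)) ^ 2 : ℝ) : ℂ)) := by
    intro n
    rw [hcexp]
    congr 1
    simp only [gPhase, gFreq, gRoot, hr]
    push_cast
    ring
  have hrinv : Real.sqrt (r⁻¹) = Real.sqrt ((p.2 : ℝ) / p.1) := by rw [hr, inv_div]
  rw [mul_sub, hu4, hu4', hrinv]
  set E : ℂ := cexp ((v / 4 : ℝ) : ℂ) * (Real.sqrt r : ℂ) * cexp (-(I * yZero δ / 4)) with hE
  set E' : ℂ := cexp ((v / 4 : ℝ) : ℂ) * cexp (-(I * yZero δ / 4)) with hE'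
  congr 1
  · -- theta part
    calc ((pairCoeff X p : ℝ) : ℂ) * (E * (2 * ∑' n : ℕ, cexp (-(π * ((n : ℂ) + 1) ^ 2 * cexp u))))
        = (((pairCoeff X p : ℝ) : ℂ) * E * 2) * ∑' n : ℕ, cexp (-(π * ((n : ℂ) + 1) ^ 2 * cexp u)) := by ring
      _ = ∑' n : ℕ, (((pairCoeff X p : ℝ) : ℂ) * E * 2) * cexp (-(π * ((n : ℂ) + 1) ^ 2 * cexp u)) :=
          tsum_mul_left.symm
      _ = ∑' n : ℕ, (2 * E') * gTerm X δ p n (Real.exp (v / 2)) := by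
          refine tsum_congr fun n ↦ ?_
          rw [hgauss n, gTerm, ← hc1, hE, hE']
          push_cast
          ring
      _ = 2 * E' * ∑' n : ℕ, gTerm X δ p n (Real.exp (v / 2)) := tsum_mul_left
      _ = _ := by rw [hE']; ring
  · rw [← hc2]
    push_cast
    ring

/-- **`f̃(v) = 2e^{v/4}e^{-iy₀/4} g(e^{v/2}) - e^{-v/4}e^{iy₀/4} φ(1)φ(0)`** for real `v`
(Titchmarsh §10.10, `f(y)` in terms of `g`). [cite: Titchmarsh1986, §10.10] -/
theorem ftil_eq_gfun (hδ : 0 < δ) (hδ1 : δ ≤ 1) (X v : ℝ) :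
    ftil X δ v = 2 * cexp ((v / 4 : ℝ) : ℂ) * cexp (-(I * yZero δ / 4)) * gfun X δ (Real.exp (v / 2)) -
      cexp ((-(v / 4) : ℝ) : ℂ) * cexp (I * yZero δ / 4) * (phiProd X : ℂ) := by
  have hP : phiProd X = ∑ p ∈ mollRange X ×ˢ mollRange X, selbergBeta X p.1 * selbergBeta X p.2 / p.1 := by
    rw [phiProd, Finset.sum_mul_sum, Finset.sum_product]
    refine Finset.sum_congr rfl fun μ _ ↦ Finset.sum_congr rfl fun ν _ ↦ ?_
    ring
  rw [ftil, Finset.sum_congr rfl fun p hp ↦ pairCoeff_mul_hardyShift hδ hδ1 hp v, Finset.sum_sub_distrib,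
    gfun, Finset.mul_sum, ← Finset.mul_sum, hP]
  push_cast
  congr 1
  rw [Finset.mul_sum]

/-- **`|f̃(v)|² ≤ 8e^{v/2}|g(e^{v/2})|² + 2e^{-v/2} P₀²`.** [folklore] -/
theorem norm_sq_ftil_le (hδ : 0 < δ) (hδ1 : δ ≤ 1) (X v : ℝ) :
    ‖ftil X δ v‖ ^ 2 ≤ 8 * Real.exp (v / 2) * ‖gfun X δ (Real.exp (v / 2))‖ ^ 2 + 2 * Real.exp (-(v / 2)) * phiProd X ^ 2 := by
  rw [ftil_eq_gfun hδ hδ1]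
  set A := 2 * cexp ((v / 4 : ℝ) : ℂ) * cexp (-(I * yZero δ / 4)) * gfun X δ (Real.exp (v / 2)) with hA
  set B := cexp ((-(v / 4) : ℝ) : ℂ) * cexp (I * yZero δ / 4) * (phiProd X : ℂ) with hB
  have hnA : ‖A‖ = 2 * Real.exp (v / 4) * ‖gfun X δ (Real.exp (v / 2))‖ := by
    rw [hA, norm_mul, norm_mul, norm_mul, Complex.norm_ofNat, Complex.norm_exp, Complex.norm_exp, Complex.ofReal_re]
    simp
  have hnB : ‖B‖ = Real.exp (-(v / 4)) * |phiProd X| := by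
    rw [hB, norm_mul, norm_mul, Complex.norm_exp, Complex.norm_exp, Complex.ofReal_re, Complex.norm_real,
      Real.norm_eq_abs]
    simp
  have h1 : ‖A - B‖ ≤ ‖A‖ + ‖B‖ := norm_sub_le _ _
  have h2 : ‖A - B‖ ^ 2 ≤ 2 * ‖A‖ ^ 2 + 2 * ‖B‖ ^ 2 := by
    nlinarith [norm_nonneg (A - B), norm_nonneg A, norm_nonneg B, sq_nonneg (‖A‖ - ‖B‖)]
  have e4 : Real.exp (v / 4) ^ 2 = Real.exp (v / 2) := by rw [← Real.exp_nat_mul]; ring_nf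
  have e4' : Real.exp (-(v / 4)) ^ 2 = Real.exp (-(v / 2)) := by rw [← Real.exp_nat_mul]; ring_nf
  calc ‖A - B‖ ^ 2 ≤ 2 * ‖A‖ ^ 2 + 2 * ‖B‖ ^ 2 := h2
    _ = _ := by rw [hnA, hnB, mul_pow, mul_pow, mul_pow, e4, e4', sq_abs]; ring

end Pos

/-! ## §6 The window `∫_t^{t+h} F` -/

/-- The window kernel `k_h(v) = ∫_0^h e^{-ivw/2} dw`. [cite: Titchmarsh1986, §10.7 (10.7.1)] -/
def kWin (h v : ℝ) : ℂ := ∫ w in (0 : ℝ)..h, cexp (-(I * v * w / 2))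

/-- `k_h` is continuous. [folklore] -/
theorem continuous_kWin (h : ℝ) : Continuous (kWin h) := by
  unfold kWin
  exact intervalIntegral.continuous_parametric_intervalIntegral_of_continuous (a₀ := 0)
    (f := fun v w : ℝ ↦ cexp (-(I * v * w / 2))) (by fun_prop) continuous_const

/-- `|k_h(v)| ≤ h`. [cite: Titchmarsh1986, §10.7 (10.7.1)] -/
theorem norm_kWin_le {h : ℝ} (hh : 0 ≤ h) (v : ℝ) : ‖kWin h v‖ ≤ h := by
  unfold kWin
  have := intervalIntegral.norm_integral_le_of_norm_le_const (a := 0) (b := h) (C := 1)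
    (f := fun w : ℝ ↦ cexp (-(I * v * w / 2))) fun w _ ↦ by
      rw [Complex.norm_exp]; simp
  simpa [abs_of_nonneg hh] using this

/-- `|k_h(v)| ≤ 4/|v|` (`v ≠ 0`). [cite: Titchmarsh1986, §10.7 (10.7.1)] -/
theorem norm_kWin_le_div (h : ℝ) {v : ℝ} (hv : v ≠ 0) : ‖kWin h v‖ ≤ 4 / |v| := by
  have hc : (-(I * v / 2) : ℂ) ≠ 0 := by
    simp only [ne_eq, neg_eq_zero, div_eq_zero_iff, mul_eq_zero, Complex.I_ne_zero, Complex.ofReal_eq_zero, hv,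
      OfNat.ofNat_ne_zero, or_self, not_false_eq_true]
  have heq : kWin h v = (cexp (-(I * v / 2) * h) - cexp (-(I * v / 2) * (0 : ℝ))) / (-(I * v / 2)) := by
    rw [kWin, ← integral_exp_mul_complex hc]
    congr 1; funext w; congr 1; ring
  rw [heq, norm_div]
  have hden : ‖(-(I * v / 2) : ℂ)‖ = |v| / 2 := by
    rw [norm_neg, norm_div, norm_mul, Complex.norm_I, Complex.norm_real, Real.norm_eq_abs, Complex.norm_ofNat, one_mul]
  have hnum : ‖cexp (-(I * v / 2) * h) - cexp (-(I * v / 2) * (0 : ℝ))‖ ≤ 2 := by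
    refine (norm_sub_le _ _).trans ?_
    rw [Complex.norm_exp, Complex.norm_exp]
    simp only [Complex.ofReal_zero, mul_zero, Complex.zero_re, Real.exp_zero]
    have : (-(I * (v : ℂ) / 2) * h).re = 0 := by simp
    rw [this, Real.exp_zero]; norm_num
  rw [hden, div_le_div_iff₀ (by positivity) (abs_pos.mpr hv)]
  nlinarith [abs_nonneg v]

/-- **The window `W(t) = ∫_t^{t+h} F(u) du`.** [cite: Titchmarsh1986, §10.9] -/
def selbergWindow (X δ h t : ℝ) : ℝ := ∫ u in t..(t + h), selbergF X δ u

/-- `∫_t^{t+h} e^{-ivu/2} du = e^{-ivt/2} k_h(v)`. [folklore] -/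
theorem integral_cexp_window (h t v : ℝ) :
    ∫ u in t..(t + h), cexp (↑(-2 * π * v * (u / (4 * π))) * I) = cexp (↑(-2 * π * v * (t / (4 * π))) * I) * kWin h v := by
  rw [kWin, ← intervalIntegral.integral_const_mul]
  have := intervalIntegral.integral_comp_add_left (a := 0) (b := h)
    (fun u : ℝ ↦ cexp (↑(-2 * π * v * (u / (4 * π))) * I)) t
  rw [add_zero] at this
  rw [← this]
  refine intervalIntegral.integral_congr fun w _ ↦ ?_
  rw [← Complex.exp_add]
  congr 1
  have hπ : (π : ℂ) ≠ 0 := Complex.ofReal_ne_zero.mpr Real.pi_pos.ne'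
  push_cast
  field_simp
  ring

/-- **`∫_t^{t+h} F = 𝓕(f̃ k_h)(t/4π)/2`** (`h > 0`). [cite: Titchmarsh1986, §10.9, §10.10] -/
theorem selbergWindow_eq_fourier (hδ : 0 < δ) (hδ1 : δ ≤ 1) {h : ℝ} (hh : 0 < h) (X t : ℝ) :
    ((selbergWindow X δ h t : ℝ) : ℂ) = 𝓕 (fun v : ℝ ↦ ftil X δ v * kWin h v) (t / (4 * π)) / 2 := by
  have hi := integrable_ftil hδ hδ1 X
  rw [selbergWindow, ← intervalIntegral.integral_ofReal,
    intervalIntegral.integral_congr (g := fun u : ℝ ↦ 𝓕 (ftil X δ) (u / (4 * π)) / 2)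
      (fun u _ ↦ selbergF_eq_fourier_ftil hδ hδ1 X u),
    intervalIntegral.integral_div, Real.fourier_real_eq_integral_exp_smul]
  congr 1
  simp only [Real.fourier_real_eq_integral_exp_smul, smul_eq_mul]
  rw [intervalIntegral.integral_of_le (by linarith)]
  -- Fubini on `Ioc t (t+h) × ℝ`
  set G : ℝ → ℝ → ℂ := fun u v ↦ cexp (↑(-2 * π * v * (u / (4 * π))) * I) * ftil X δ v with hG
  have hGint : Integrable (Function.uncurry G) ((volume.restrict (Ioc t (t + h))).prod volume) := by
    have hmaj : Integrable (fun z : ℝ × ℝ ↦ (1 : ℝ) * ‖ftil X δ z.2‖) ((volume.restrict (Ioc t (t + h))).prod volume) :=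
      Integrable.mul_prod (integrable_const (1 : ℝ)) hi.norm
    refine hmaj.mono' ?_ (Eventually.of_forall fun z ↦ ?_)
    · have hc : Continuous (Function.uncurry G) := by
        have := continuous_ftil hδ hδ1 X
        simp only [hG, Function.uncurry_def]
        fun_prop
      exact hc.aestronglyMeasurable
    · obtain ⟨u, v⟩ := z
      simp only [Function.uncurry_apply_pair, hG]
      rw [norm_mul, Complex.norm_exp_ofReal_mul_I, one_mul]
  have hswap := MeasureTheory.integral_integral_swap hGint
  simp only [hG] at hswap
  rw [hswap]
  refine integral_congr_ae (Eventually.of_forall fun v ↦ ?_)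
  simp only
  rw [← intervalIntegral.integral_of_le (by linarith), intervalIntegral.integral_mul_const, integral_cexp_window]
  ring

/-- `f̃ k_h` is integrable and in `L²`. [folklore] -/
theorem integrable_memLp_ftil_mul_kWin (hδ : 0 < δ) (hδ1 : δ ≤ 1) {h : ℝ} (hh : 0 < h) (X : ℝ) :
    Integrable (fun v : ℝ ↦ ftil X δ v * kWin h v) ∧ MemLp (fun v : ℝ ↦ ftil X δ v * kWin h v) 2 volume := by
  have hi : Integrable (fun v : ℝ ↦ ftil X δ v * kWin h v) :=
    (integrable_ftil hδ hδ1 X).mul_bdd (c := h) (continuous_kWin h).aestronglyMeasurable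
      (Eventually.of_forall fun v ↦ norm_kWin_le hh.le v)
  obtain ⟨B, hB⟩ := exists_bound_ftil hδ hδ1 X
  refine ⟨hi, Literature.Analysis.FluidPDE.FourierNS.memLp_two_of_bound hi (C := B * h) fun v ↦ ?_⟩
  rw [norm_mul]
  exact mul_le_mul (hB v) (norm_kWin_le hh.le v) (norm_nonneg _) ((norm_nonneg _).trans (hB v))

/-- **`∫ (∫_t^{t+h}F)² dt = π ∫ |f̃ k_h|²`**, with integrability. [cite: Titchmarsh1986, §10.9, §10.10] -/
theorem integral_selbergWindow_sq_eq (hδ : 0 < δ) (hδ1 : δ ≤ 1) {h : ℝ} (hh : 0 < h) (X : ℝ) :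
    Integrable (fun t : ℝ ↦ selbergWindow X δ h t ^ 2) ∧
      ∫ t : ℝ, selbergWindow X δ h t ^ 2 = π * ∫ v : ℝ, ‖ftil X δ v * kWin h v‖ ^ 2 := by
  obtain ⟨hi, h2⟩ := integrable_memLp_ftil_mul_kWin hδ hδ1 hh X
  exact integral_sq_eq_pi_mul hi h2 (selbergWindow_eq_fourier hδ hδ1 hh X)

/-- `k_h(-v) = conj k_h(v)` (`h ≥ 0`). [folklore] -/
theorem kWin_neg {h : ℝ} (hh : 0 ≤ h) (v : ℝ) : kWin h (-v) = conj (kWin h v) := by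
  rw [kWin, kWin, intervalIntegral.integral_of_le hh, intervalIntegral.integral_of_le hh, ← integral_conj]
  refine setIntegral_congr_fun measurableSet_Ioc fun w _ ↦ ?_
  rw [← Complex.exp_conj]
  congr 1
  simp only [map_neg, map_div₀, map_mul, Complex.conj_I, Complex.conj_ofReal, map_ofNat]
  push_cast; ring

/-- `|f̃ k_h|` is even (`h ≥ 0`). [folklore] -/
theorem norm_ftil_mul_kWin_neg (hδ : 0 < δ) (hδ1 : δ ≤ 1) {h : ℝ} (hh : 0 ≤ h) (X v : ℝ) :
    ‖ftil X δ (-v) * kWin h (-v)‖ = ‖ftil X δ v * kWin h v‖ := by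
  rw [norm_mul, norm_mul, norm_ftil_neg hδ hδ1, kWin_neg hh, Complex.norm_conj]

/-- **`∫|f̃ k_h|² = 2∫_0^∞ |f̃ k_h|²`** (`h ≥ 0`). [folklore] -/
theorem integral_norm_sq_ftil_mul_kWin_eq (hδ : 0 < δ) (hδ1 : δ ≤ 1) {h : ℝ} (hh : 0 ≤ h) (X : ℝ) :
    ∫ v : ℝ, ‖ftil X δ v * kWin h v‖ ^ 2 = 2 * ∫ v in Ioi (0 : ℝ), ‖ftil X δ v * kWin h v‖ ^ 2 := by
  rw [← integral_comp_abs (f := fun v ↦ ‖ftil X δ v * kWin h v‖ ^ 2)]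
  refine integral_congr_ae (Eventually.of_forall fun v ↦ ?_)
  simp only
  rcases le_or_gt 0 v with hv | hv
  · rw [abs_of_nonneg hv]
  · rw [abs_of_neg hv, norm_ftil_mul_kWin_neg hδ hδ1 hh]

end FourierSide

end Literature.NumberTheory.LFunctions.SelbergMollifier
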